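import Summits.QuantumFields.YangMills.Theorems.UnitScaleTiltProp7ConjFrameReg335
import Summits.QuantumFields.YangMills.Theorems.UnitScaleTiltProp7LemmaHCurvedOfRows
import HarnessLib

/-!
# Route `UnitScaleTilt`, crux K1 «MinimiserStabilityRegPr» (stmt-QuantumFields-19200), route-R E′ path (α′), LEMMA-H-curved (design (x2′-corner)), file F-H7a —
# THE FRAMES OF ✓ `lemmaH_curved_of_rows` FROM (3.35) CUBE GAUGES AROUND THE CENTRES: `(hFr)(hFr1)(hA)` discharged from `Reg335Cube`

Cell `ym3-torus`, extra width seat `ym-routeR-w4` (g9); row named by the LEMMA-H-curved row-holder ★routeR-w1 g5 («routeR-w4: F-H7 — GO», 2026-08-28 19:44Z; interface =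
the `(hA)(hFr)(hFr1)` hypotheses of ✓ `Prop7LemmaHCurvedOfRows.lemmaH_curved_of_rows` VERBATIM).  THEOREMS ONLY (0 `def`, 0 `sorry`); `--supports stmt-QuantumFields-19200`,
count-neutral.  YM₃ on T³ is a ladder rung (R3), not the Clay problem; nothing here claims LEMMA-H-curved, a stub, the crux or the gap.

WHAT IS PROVED (ns `…Theorems.Prop7LemmaHCurvedFramesOfReg335`).
* ★★★ `exists_frames_of_reg335` (generic lattice `P`, height `k ≤ m + K`, complete normed `ℂ`-algebra `𝔸` with `‖1‖ = 1`, ANY background `U` on the torus shifts `torusT P 0` —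
  the rows come from the gauge, no bi-contraction of `U` is used): IF every `k`-centre `y` has a cube `□_y ⊆ Site P 0` containing the SUPPORT SET of ✓p661714's predicate (`∀ ν, y_ν − Q_ν(z) ∈ {−1,0,1,2}`,
  `Q(z) = iterBlockOf k (z − (ℓ−1)∕2)`) together with its `±e_μ` neighbours, on which the background is in [Balaban1985BackgroundPropagators]'s class (3.35)
  (`Reg335Cube (torusT P 0) U η □_y ξ C`, r06's ✓`B9Eq335RegularityClasses.Reg335Cube`), THEN there are frames `Fr : Site P k → Site P 0 → 𝔸ˣ`, bi-contractive EVERYWHERE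
  (extended by `1` off the cube), normalised `Fr y (embIter k y) = 1`, with the rows `(hA)` for `a₀ := η(Cξ⁻¹)e^{η(Cξ⁻¹)}`, `a₁ := η(η(C(ξ²)⁻¹))e^{η(Cξ⁻¹)}` — the re-based (3.35)
  frames of ✓`Prop7ConjFrameReg335.frame_rows_of_reg335Cube_rebased` at the base site `embIter k y`.
* ★★ `exists_frames_of_reg335_T3` — the T³ reading in ✓p661714's letters (`P := F.P K`, `k := K − n`, `𝔸 := M₂(ℂ)`, `U := fun κ z ↦ unitsField (toUField W) ⟨z, κ⟩`).
HONEST SCOPE.  Bookkeeping over ✓p660822∕✓p661560 and ✓`Prop7HermiteFold.iterBlockOf_embIter_sub`; WHERE the cubes `□_y` with (3.35) come from (the member's cube class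
`cubeClass396` under the displayed `Prop7SectET3BgClass.ClassTransferT3`, this seat's LOCATE 3) is the next file (F-H7b); nothing of (3.35) is asserted here.

References: T. Bałaban, CMP 99 (1985) 389–434 [Balaban1985BackgroundPropagators] ((3.28) p.395, (3.35) p.396); CMP 102 (1985) 277–309 [Balaban1985Variational] (Sect. A p.280).
-/

noncomputable section

open scoped Matrix.Norms.L2Operator

namespace Summit.QuantumFields.YangMills.Theorems.Prop7LemmaHCurvedFramesOfReg335

open Literature.MathematicalPhysics.QuantumFieldTheory.Balaban1983to89
open Literature.MathematicalPhysics.QuantumFieldTheory.Balaban1983to89.T3ContinuumYM3Torus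
open B9TorusCalculus (torusT)
open B10Eq27TorusAxialLog (unitsField toUField)
open B5Eq118OneStroke (iterBlockOf)
open B15DeterminingSets (embIter)
open B9Eq335RegularityClasses (Reg335Cube)
open Summit.QuantumFields.YangMills.Theorems.Prop7HermiteFold (iterBlockOf_embIter_sub)
open Summit.QuantumFields.YangMills.Theorems.Prop7ConjFrameReg335 (frame_rows_of_reg335Cube_rebased)
open B9Thm310CommutatorDataOfPlaquettes (bicontr_mul bicontr_inv)

/-! ## §1 Frames from (3.35) cube gauges around the centres (generic lattice) -/

section Generic

variable {P : Params} {k : ℕ}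
variable {𝔸 : Type} [NormedRing 𝔸] [NormedAlgebra ℂ 𝔸] [CompleteSpace 𝔸] [NormOneClass 𝔸]

/-- the centre `embIter k y` satisfies its own support predicate (`Q(embIter k y) = y`, ✓`iterBlockOf_embIter_sub`). [cite: Balaban1984PropagatorsI, (1.29)-(1.31) p.23] -/
theorem support_embIter (hk : k ≤ P.m + P.K) (y : Site P k) (ν : Fin P.d) :
    y ν = (iterBlockOf k (fun κ => (embIter k y) κ - ((((P.L ^ k - 1) / 2 : ℕ)) : ZMod (P.sitesPerDir 0)))) ν - 1
    ∨ y ν = (iterBlockOf k (fun κ => (embIter k y) κ - ((((P.L ^ k - 1) / 2 : ℕ)) : ZMod (P.sitesPerDir 0)))) ν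
    ∨ y ν = (iterBlockOf k (fun κ => (embIter k y) κ - ((((P.L ^ k - 1) / 2 : ℕ)) : ZMod (P.sitesPerDir 0)))) ν + 1
    ∨ y ν = (iterBlockOf k (fun κ => (embIter k y) κ - ((((P.L ^ k - 1) / 2 : ℕ)) : ZMod (P.sitesPerDir 0)))) ν + 2 := by
  rw [iterBlockOf_embIter_sub hk y]
  exact Or.inr (Or.inl rfl)

/-- ★★★ **THE FRAMES OF `lemmaH_curved_of_rows` FROM (3.35) CUBE GAUGES**: see the module docstring. [cite: Balaban1985BackgroundPropagators, (3.35) p.396, (3.28) p.395] -/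
theorem exists_frames_of_reg335 (hk : k ≤ P.m + P.K) (U : Fin P.d → Site P 0 → 𝔸ˣ) {η ξ C : ℝ} (hη : 0 < η)
    (hReg : ∀ y : Site P k, ∃ cube : Set (Site P 0),
      (∀ z : Site P 0, (∀ ν : Fin P.d, (y ν = (iterBlockOf k (fun κ => z κ - ((((P.L ^ k - 1) / 2 : ℕ)) : ZMod (P.sitesPerDir 0)))) ν - 1
          ∨ y ν = (iterBlockOf k (fun κ => z κ - ((((P.L ^ k - 1) / 2 : ℕ)) : ZMod (P.sitesPerDir 0)))) ν
          ∨ y ν = (iterBlockOf k (fun κ => z κ - ((((P.L ^ k - 1) / 2 : ℕ)) : ZMod (P.sitesPerDir 0)))) ν + 1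
          ∨ y ν = (iterBlockOf k (fun κ => z κ - ((((P.L ^ k - 1) / 2 : ℕ)) : ZMod (P.sitesPerDir 0)))) ν + 2)) →
        z ∈ cube ∧ ∀ μ : Fin P.d, torusT P 0 μ z ∈ cube ∧ (torusT P 0 μ).symm z ∈ cube) ∧
      Reg335Cube (torusT P 0) U η cube ξ C) :
    ∃ Fr : Site P k → Site P 0 → 𝔸ˣ,
      (∀ y z, ‖(Fr y z : 𝔸)‖ ≤ 1 ∧ ‖(((Fr y z)⁻¹ : 𝔸ˣ) : 𝔸)‖ ≤ 1) ∧
      (∀ y, Fr y (embIter k y) = 1) ∧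
      (∀ (y : Site P k) (z : Site P 0), (∀ ν : Fin P.d, (y ν = (iterBlockOf k (fun κ => z κ - ((((P.L ^ k - 1) / 2 : ℕ)) : ZMod (P.sitesPerDir 0)))) ν - 1
          ∨ y ν = (iterBlockOf k (fun κ => z κ - ((((P.L ^ k - 1) / 2 : ℕ)) : ZMod (P.sitesPerDir 0)))) ν
          ∨ y ν = (iterBlockOf k (fun κ => z κ - ((((P.L ^ k - 1) / 2 : ℕ)) : ZMod (P.sitesPerDir 0)))) ν + 1
          ∨ y ν = (iterBlockOf k (fun κ => z κ - ((((P.L ^ k - 1) / 2 : ℕ)) : ZMod (P.sitesPerDir 0)))) ν + 2)) →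
        ∀ μ : Fin P.d,
          ‖(((Fr y z)⁻¹ * U μ z * Fr y (torusT P 0 μ z) : 𝔸ˣ) : 𝔸) - 1‖ ≤ η * (C * ξ⁻¹) * Real.exp (η * (C * ξ⁻¹))
          ∧ ‖(((Fr y ((torusT P 0 μ).symm z))⁻¹ * U μ ((torusT P 0 μ).symm z) * Fr y z : 𝔸ˣ) : 𝔸) - 1‖ ≤ η * (C * ξ⁻¹) * Real.exp (η * (C * ξ⁻¹))
          ∧ ‖(((Fr y z)⁻¹ * U μ z * Fr y (torusT P 0 μ z) : 𝔸ˣ) : 𝔸)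
              - (((Fr y ((torusT P 0 μ).symm z))⁻¹ * U μ ((torusT P 0 μ).symm z) * Fr y z : 𝔸ˣ) : 𝔸)‖
                ≤ η * (η * (C * (ξ ^ 2)⁻¹)) * Real.exp (η * (C * ξ⁻¹))) := by
  classical
  choose cube hcov hR using hReg
  have hfr := fun y => frame_rows_of_reg335Cube_rebased (torusT P 0) U hη (hR y)
  choose u hu hreb using hfr
  -- the centre lies in its cube
  have hc : ∀ y, embIter k y ∈ cube y := fun y => (hcov y (embIter k y) (support_embIter hk y)).1
  refine ⟨fun y z => if z ∈ cube y then (u y z)⁻¹ * u y (embIter k y) else 1, fun y z => ?_, fun y => ?_, fun y z hz μ => ?_⟩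
  · by_cases hz : z ∈ cube y
    · simp only [hz, if_true]
      exact bicontr_mul (bicontr_inv (hu y z hz)) (hu y (embIter k y) (hc y))
    · simp only [hz, if_false, inv_one, Units.val_one, norm_one, le_refl, and_self]
  · simp only [hc y, if_true, inv_mul_cancel]
  · obtain ⟨hz0, hzμ⟩ := hcov y z hz
    have hz1 : torusT P 0 μ z ∈ cube y := (hzμ μ).1
    have hz2 : (torusT P 0 μ).symm z ∈ cube y := (hzμ μ).2
    have hT : torusT P 0 μ ((torusT P 0 μ).symm z) = z := Equiv.apply_symm_apply _ _
    obtain ⟨-, -, hsize, hdiff⟩ := hreb y (embIter k y) (hc y)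
    have h1 := hsize μ z hz0
    have h2 := hsize μ ((torusT P 0 μ).symm z) hz2
    have h3 := hdiff μ z hz0 hz2
    simp only [hT] at h2 h3
    simp only [hz0, hz1, hz2, if_true]
    exact ⟨h1, h2, h3⟩

end Generic

/-! ## §2 The T³ reading in ✓p661714's letters -/

section T3

/-- ★★ **THE FRAMES OF `lemmaH_curved_of_rows`, T³ LETTERS**: for the run `K`, height `n`, an SU(2) background `W` read as `unitsField (toUField W)`, spacing `η > 0`, and per-centre
cubes carrying (3.35) at scale `ξ` with constant `C` and covering the support sets with their `±e_μ` neighbours: frames `Fr` with `(hFr)`, `(hFr1)`, `(hA)` for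
`a₀ = η(Cξ⁻¹)e^{η(Cξ⁻¹)}`, `a₁ = η(η(C(ξ²)⁻¹))e^{η(Cξ⁻¹)}`. [cite: Balaban1985BackgroundPropagators, (3.35) p.396; Balaban1985Variational, Sect. A p.280] -/
theorem exists_frames_of_reg335_T3 (F : T3Family) (K n : ℕ) (hk : K - n ≤ (F.P K).m + (F.P K).K)
    (W : GaugeField (F.P K) 0 (Matrix.specialUnitaryGroup (Fin 2) ℂ)) {η ξ C : ℝ} (hη : 0 < η)
    (hReg : ∀ y : Site (F.P K) (K - n), ∃ cube : Set (Site (F.P K) 0),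
      (∀ z : Site (F.P K) 0, (∀ ν : Fin (F.P K).d,
          (y ν = (iterBlockOf (K - n) (fun κ => z κ - (((((F.P K).L ^ (K - n) - 1) / 2 : ℕ)) : ZMod ((F.P K).sitesPerDir 0)))) ν - 1
          ∨ y ν = (iterBlockOf (K - n) (fun κ => z κ - (((((F.P K).L ^ (K - n) - 1) / 2 : ℕ)) : ZMod ((F.P K).sitesPerDir 0)))) ν
          ∨ y ν = (iterBlockOf (K - n) (fun κ => z κ - (((((F.P K).L ^ (K - n) - 1) / 2 : ℕ)) : ZMod ((F.P K).sitesPerDir 0)))) ν + 1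
          ∨ y ν = (iterBlockOf (K - n) (fun κ => z κ - (((((F.P K).L ^ (K - n) - 1) / 2 : ℕ)) : ZMod ((F.P K).sitesPerDir 0)))) ν + 2)) →
        z ∈ cube ∧ ∀ μ : Fin (F.P K).d, torusT (F.P K) 0 μ z ∈ cube ∧ (torusT (F.P K) 0 μ).symm z ∈ cube) ∧
      Reg335Cube (torusT (F.P K) 0) (fun κ z => unitsField (toUField W) ⟨z, κ⟩) η cube ξ C) :
    ∃ Fr : Site (F.P K) (K - n) → Site (F.P K) 0 → (Matrix (Fin 2) (Fin 2) ℂ)ˣ,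
      (∀ y z, ‖(Fr y z : Matrix (Fin 2) (Fin 2) ℂ)‖ ≤ 1 ∧ ‖(((Fr y z)⁻¹ : (Matrix (Fin 2) (Fin 2) ℂ)ˣ) : Matrix (Fin 2) (Fin 2) ℂ)‖ ≤ 1) ∧
      (∀ y, Fr y (embIter (K - n) y) = 1) ∧
      (∀ (y : Site (F.P K) (K - n)) (z : Site (F.P K) 0),
        (∀ ν : Fin (F.P K).d,
          (y ν = (iterBlockOf (K - n) (fun κ => z κ - (((((F.P K).L ^ (K - n) - 1) / 2 : ℕ)) : ZMod ((F.P K).sitesPerDir 0)))) ν - 1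
          ∨ y ν = (iterBlockOf (K - n) (fun κ => z κ - (((((F.P K).L ^ (K - n) - 1) / 2 : ℕ)) : ZMod ((F.P K).sitesPerDir 0)))) ν
          ∨ y ν = (iterBlockOf (K - n) (fun κ => z κ - (((((F.P K).L ^ (K - n) - 1) / 2 : ℕ)) : ZMod ((F.P K).sitesPerDir 0)))) ν + 1
          ∨ y ν = (iterBlockOf (K - n) (fun κ => z κ - (((((F.P K).L ^ (K - n) - 1) / 2 : ℕ)) : ZMod ((F.P K).sitesPerDir 0)))) ν + 2)) →
        ∀ μ : Fin (F.P K).d,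
          ‖(((Fr y z)⁻¹ * unitsField (toUField W) ⟨z, μ⟩ * Fr y (torusT (F.P K) 0 μ z) : (Matrix (Fin 2) (Fin 2) ℂ)ˣ) : Matrix (Fin 2) (Fin 2) ℂ) - 1‖
              ≤ η * (C * ξ⁻¹) * Real.exp (η * (C * ξ⁻¹))
          ∧ ‖(((Fr y ((torusT (F.P K) 0 μ).symm z))⁻¹ * unitsField (toUField W) ⟨(torusT (F.P K) 0 μ).symm z, μ⟩ * Fr y z : (Matrix (Fin 2) (Fin 2) ℂ)ˣ) :
              Matrix (Fin 2) (Fin 2) ℂ) - 1‖ ≤ η * (C * ξ⁻¹) * Real.exp (η * (C * ξ⁻¹))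
          ∧ ‖(((Fr y z)⁻¹ * unitsField (toUField W) ⟨z, μ⟩ * Fr y (torusT (F.P K) 0 μ z) : (Matrix (Fin 2) (Fin 2) ℂ)ˣ) : Matrix (Fin 2) (Fin 2) ℂ)
              - (((Fr y ((torusT (F.P K) 0 μ).symm z))⁻¹ * unitsField (toUField W) ⟨(torusT (F.P K) 0 μ).symm z, μ⟩ * Fr y z : (Matrix (Fin 2) (Fin 2) ℂ)ˣ) :
                Matrix (Fin 2) (Fin 2) ℂ)‖ ≤ η * (η * (C * (ξ ^ 2)⁻¹)) * Real.exp (η * (C * ξ⁻¹))) := by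
  exact exists_frames_of_reg335 hk (fun κ z => unitsField (toUField W) ⟨z, κ⟩) hη hReg

end T3

end Summit.QuantumFields.YangMills.Theorems.Prop7LemmaHCurvedFramesOfReg335

end
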